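import Mathlib
import Summits.Ventures.PercRepro2.SortedPairs5Code

/-!
# Sorted labellings of 5 pairs of points, II: swapping a misoriented pair (blind cell PercRepro2, night-3, 2026-08-24)

Swapping the ends of a pair whose first end carries the larger label lowers the code of the `10`
endpoint labels (`code10_swapAt5_lt_k`): the old label of the second end is an index of the
unchanged prefix (`lab_prefix`).
-/

namespace Summit.Ventures.PercRepro2

open UnionCluster

namespace CovForm

namespace TwoTyped

open OneTyped

section Sorted5

open Classical

variable {V : Type*} {E : Type*} (ends : E → Sym2 V) (o a₁ a₂ a₃ b : V) (ω : Config E)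

/-- Swapping the ends of pair `0` changes no point before index `5`. -/
lemma pt_swapAt5_0 (ps : Fin 5 → V × V) (j : ℕ) (hj : j ≤ 4) :
    pt o a₁ a₂ a₃ b (xsOf5 (swapAt5 ps 0)) j = pt o a₁ a₂ a₃ b (xsOf5 ps) j := by
  interval_cases j <;> rfl

/-- **Swapping a misoriented pair lowers the code** (pair `0`). -/
lemma code10_swapAt5_lt_0 (ps : Fin 5 → V × V)
    (h : lab ends o a₁ a₂ a₃ b (xsOf5 ps) ω 6 < lab ends o a₁ a₂ a₃ b (xsOf5 ps) ω 5) :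
    code10 ends o a₁ a₂ a₃ b ω (xsOf5 (swapAt5 ps 0)) < code10 ends o a₁ a₂ a₃ b ω (xsOf5 ps) := by
  have hpre : ∀ j ≤ 4, pt o a₁ a₂ a₃ b (xsOf5 (swapAt5 ps 0)) j = pt o a₁ a₂ a₃ b (xsOf5 ps) j := pt_swapAt5_0 o a₁ a₂ a₃ b ps
  have hle := lab_le ends o a₁ a₂ a₃ b (xsOf5 ps) ω 5
  have hs := lab_spec ends o a₁ a₂ a₃ b (xsOf5 ps) ω 6
  have hj : lab ends o a₁ a₂ a₃ b (xsOf5 ps) ω 6 ≤ 4 := by omega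
  have hnew : lab ends o a₁ a₂ a₃ b (xsOf5 (swapAt5 ps 0)) ω 5 ≤ lab ends o a₁ a₂ a₃ b (xsOf5 ps) ω 6 :=
    Nat.find_min' (p := fun j => Conn ends ω (pt o a₁ a₂ a₃ b (xsOf5 (swapAt5 ps 0)) j) (pt o a₁ a₂ a₃ b (xsOf5 (swapAt5 ps 0)) 5))
      ⟨5, conn_refl ends ω _⟩ (by rw [hpre _ hj]; simpa [swapAt5] using hs)
  refine code10_lt_0 ends o a₁ a₂ a₃ b ω (xsOf5 ps) (xsOf5 (swapAt5 ps 0))  ?_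
  omega

/-- Swapping the ends of pair `1` changes no point before index `7`. -/
lemma pt_swapAt5_1 (ps : Fin 5 → V × V) (j : ℕ) (hj : j ≤ 6) :
    pt o a₁ a₂ a₃ b (xsOf5 (swapAt5 ps 1)) j = pt o a₁ a₂ a₃ b (xsOf5 ps) j := by
  interval_cases j <;> rfl

/-- **Swapping a misoriented pair lowers the code** (pair `1`). -/
lemma code10_swapAt5_lt_1 (ps : Fin 5 → V × V)
    (h : lab ends o a₁ a₂ a₃ b (xsOf5 ps) ω 8 < lab ends o a₁ a₂ a₃ b (xsOf5 ps) ω 7) :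
    code10 ends o a₁ a₂ a₃ b ω (xsOf5 (swapAt5 ps 1)) < code10 ends o a₁ a₂ a₃ b ω (xsOf5 ps) := by
  have hpre : ∀ j ≤ 6, pt o a₁ a₂ a₃ b (xsOf5 (swapAt5 ps 1)) j = pt o a₁ a₂ a₃ b (xsOf5 ps) j := pt_swapAt5_1 o a₁ a₂ a₃ b ps
  have hle := lab_le ends o a₁ a₂ a₃ b (xsOf5 ps) ω 7
  have hs := lab_spec ends o a₁ a₂ a₃ b (xsOf5 ps) ω 8
  have hj : lab ends o a₁ a₂ a₃ b (xsOf5 ps) ω 8 ≤ 6 := by omega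
  have hnew : lab ends o a₁ a₂ a₃ b (xsOf5 (swapAt5 ps 1)) ω 7 ≤ lab ends o a₁ a₂ a₃ b (xsOf5 ps) ω 8 :=
    Nat.find_min' (p := fun j => Conn ends ω (pt o a₁ a₂ a₃ b (xsOf5 (swapAt5 ps 1)) j) (pt o a₁ a₂ a₃ b (xsOf5 (swapAt5 ps 1)) 7))
      ⟨7, conn_refl ends ω _⟩ (by rw [hpre _ hj]; simpa [swapAt5] using hs)
  refine code10_lt_2 ends o a₁ a₂ a₃ b ω (xsOf5 ps) (xsOf5 (swapAt5 ps 1)) (lab_prefix ends o a₁ a₂ a₃ b _ _ ω 5 (fun i hi => hpre i (by omega))) (lab_prefix ends o a₁ a₂ a₃ b _ _ ω 6 (fun i hi => hpre i (by omega))) ?_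
  omega

/-- Swapping the ends of pair `2` changes no point before index `9`. -/
lemma pt_swapAt5_2 (ps : Fin 5 → V × V) (j : ℕ) (hj : j ≤ 8) :
    pt o a₁ a₂ a₃ b (xsOf5 (swapAt5 ps 2)) j = pt o a₁ a₂ a₃ b (xsOf5 ps) j := by
  interval_cases j <;> rfl

/-- **Swapping a misoriented pair lowers the code** (pair `2`). -/
lemma code10_swapAt5_lt_2 (ps : Fin 5 → V × V)
    (h : lab ends o a₁ a₂ a₃ b (xsOf5 ps) ω 10 < lab ends o a₁ a₂ a₃ b (xsOf5 ps) ω 9) :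
    code10 ends o a₁ a₂ a₃ b ω (xsOf5 (swapAt5 ps 2)) < code10 ends o a₁ a₂ a₃ b ω (xsOf5 ps) := by
  have hpre : ∀ j ≤ 8, pt o a₁ a₂ a₃ b (xsOf5 (swapAt5 ps 2)) j = pt o a₁ a₂ a₃ b (xsOf5 ps) j := pt_swapAt5_2 o a₁ a₂ a₃ b ps
  have hle := lab_le ends o a₁ a₂ a₃ b (xsOf5 ps) ω 9
  have hs := lab_spec ends o a₁ a₂ a₃ b (xsOf5 ps) ω 10
  have hj : lab ends o a₁ a₂ a₃ b (xsOf5 ps) ω 10 ≤ 8 := by omega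
  have hnew : lab ends o a₁ a₂ a₃ b (xsOf5 (swapAt5 ps 2)) ω 9 ≤ lab ends o a₁ a₂ a₃ b (xsOf5 ps) ω 10 :=
    Nat.find_min' (p := fun j => Conn ends ω (pt o a₁ a₂ a₃ b (xsOf5 (swapAt5 ps 2)) j) (pt o a₁ a₂ a₃ b (xsOf5 (swapAt5 ps 2)) 9))
      ⟨9, conn_refl ends ω _⟩ (by rw [hpre _ hj]; simpa [swapAt5] using hs)
  refine code10_lt_4 ends o a₁ a₂ a₃ b ω (xsOf5 ps) (xsOf5 (swapAt5 ps 2)) (lab_prefix ends o a₁ a₂ a₃ b _ _ ω 5 (fun i hi => hpre i (by omega))) (lab_prefix ends o a₁ a₂ a₃ b _ _ ω 6 (fun i hi => hpre i (by omega))) (lab_prefix ends o a₁ a₂ a₃ b _ _ ω 7 (fun i hi => hpre i (by omega))) (lab_prefix ends o a₁ a₂ a₃ b _ _ ω 8 (fun i hi => hpre i (by omega))) ?_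
  omega

/-- Swapping the ends of pair `3` changes no point before index `11`. -/
lemma pt_swapAt5_3 (ps : Fin 5 → V × V) (j : ℕ) (hj : j ≤ 10) :
    pt o a₁ a₂ a₃ b (xsOf5 (swapAt5 ps 3)) j = pt o a₁ a₂ a₃ b (xsOf5 ps) j := by
  interval_cases j <;> rfl

/-- **Swapping a misoriented pair lowers the code** (pair `3`). -/
lemma code10_swapAt5_lt_3 (ps : Fin 5 → V × V)
    (h : lab ends o a₁ a₂ a₃ b (xsOf5 ps) ω 12 < lab ends o a₁ a₂ a₃ b (xsOf5 ps) ω 11) :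
    code10 ends o a₁ a₂ a₃ b ω (xsOf5 (swapAt5 ps 3)) < code10 ends o a₁ a₂ a₃ b ω (xsOf5 ps) := by
  have hpre : ∀ j ≤ 10, pt o a₁ a₂ a₃ b (xsOf5 (swapAt5 ps 3)) j = pt o a₁ a₂ a₃ b (xsOf5 ps) j := pt_swapAt5_3 o a₁ a₂ a₃ b ps
  have hle := lab_le ends o a₁ a₂ a₃ b (xsOf5 ps) ω 11
  have hs := lab_spec ends o a₁ a₂ a₃ b (xsOf5 ps) ω 12
  have hj : lab ends o a₁ a₂ a₃ b (xsOf5 ps) ω 12 ≤ 10 := by omega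
  have hnew : lab ends o a₁ a₂ a₃ b (xsOf5 (swapAt5 ps 3)) ω 11 ≤ lab ends o a₁ a₂ a₃ b (xsOf5 ps) ω 12 :=
    Nat.find_min' (p := fun j => Conn ends ω (pt o a₁ a₂ a₃ b (xsOf5 (swapAt5 ps 3)) j) (pt o a₁ a₂ a₃ b (xsOf5 (swapAt5 ps 3)) 11))
      ⟨11, conn_refl ends ω _⟩ (by rw [hpre _ hj]; simpa [swapAt5] using hs)
  refine code10_lt_6 ends o a₁ a₂ a₃ b ω (xsOf5 ps) (xsOf5 (swapAt5 ps 3)) (lab_prefix ends o a₁ a₂ a₃ b _ _ ω 5 (fun i hi => hpre i (by omega))) (lab_prefix ends o a₁ a₂ a₃ b _ _ ω 6 (fun i hi => hpre i (by omega))) (lab_prefix ends o a₁ a₂ a₃ b _ _ ω 7 (fun i hi => hpre i (by omega))) (lab_prefix ends o a₁ a₂ a₃ b _ _ ω 8 (fun i hi => hpre i (by omega))) (lab_prefix ends o a₁ a₂ a₃ b _ _ ω 9 (fun i hi => hpre i (by omega))) (lab_prefix ends o a₁ a₂ a₃ b _ _ ω 10 (fun i hi => hpre i (by omega))) ?_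
  omega

/-- Swapping the ends of pair `4` changes no point before index `13`. -/
lemma pt_swapAt5_4 (ps : Fin 5 → V × V) (j : ℕ) (hj : j ≤ 12) :
    pt o a₁ a₂ a₃ b (xsOf5 (swapAt5 ps 4)) j = pt o a₁ a₂ a₃ b (xsOf5 ps) j := by
  interval_cases j <;> rfl

/-- **Swapping a misoriented pair lowers the code** (pair `4`). -/
lemma code10_swapAt5_lt_4 (ps : Fin 5 → V × V)
    (h : lab ends o a₁ a₂ a₃ b (xsOf5 ps) ω 14 < lab ends o a₁ a₂ a₃ b (xsOf5 ps) ω 13) :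
    code10 ends o a₁ a₂ a₃ b ω (xsOf5 (swapAt5 ps 4)) < code10 ends o a₁ a₂ a₃ b ω (xsOf5 ps) := by
  have hpre : ∀ j ≤ 12, pt o a₁ a₂ a₃ b (xsOf5 (swapAt5 ps 4)) j = pt o a₁ a₂ a₃ b (xsOf5 ps) j := pt_swapAt5_4 o a₁ a₂ a₃ b ps
  have hle := lab_le ends o a₁ a₂ a₃ b (xsOf5 ps) ω 13
  have hs := lab_spec ends o a₁ a₂ a₃ b (xsOf5 ps) ω 14
  have hj : lab ends o a₁ a₂ a₃ b (xsOf5 ps) ω 14 ≤ 12 := by omega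
  have hnew : lab ends o a₁ a₂ a₃ b (xsOf5 (swapAt5 ps 4)) ω 13 ≤ lab ends o a₁ a₂ a₃ b (xsOf5 ps) ω 14 :=
    Nat.find_min' (p := fun j => Conn ends ω (pt o a₁ a₂ a₃ b (xsOf5 (swapAt5 ps 4)) j) (pt o a₁ a₂ a₃ b (xsOf5 (swapAt5 ps 4)) 13))
      ⟨13, conn_refl ends ω _⟩ (by rw [hpre _ hj]; simpa [swapAt5] using hs)
  refine code10_lt_8 ends o a₁ a₂ a₃ b ω (xsOf5 ps) (xsOf5 (swapAt5 ps 4)) (lab_prefix ends o a₁ a₂ a₃ b _ _ ω 5 (fun i hi => hpre i (by omega))) (lab_prefix ends o a₁ a₂ a₃ b _ _ ω 6 (fun i hi => hpre i (by omega))) (lab_prefix ends o a₁ a₂ a₃ b _ _ ω 7 (fun i hi => hpre i (by omega))) (lab_prefix ends o a₁ a₂ a₃ b _ _ ω 8 (fun i hi => hpre i (by omega))) (lab_prefix ends o a₁ a₂ a₃ b _ _ ω 9 (fun i hi => hpre i (by omega))) (lab_prefix ends o a₁ a₂ a₃ b _ _ ω 10 (fun i hi => hpre i (by omega))) (lab_prefix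 ends o a₁ a₂ a₃ b _ _ ω 11 (fun i hi => hpre i (by omega))) (lab_prefix ends o a₁ a₂ a₃ b _ _ ω 12 (fun i hi => hpre i (by omega))) ?_
  omega

end Sorted5

end TwoTyped

end CovForm

end Summit.Ventures.PercRepro2
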